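import Mathlib
import Literature.Probability.Percolation.SeriesParallelReductionLaw
import Literature.Probability.Percolation.BondPercolationSymmetry
import Literature.Probability.Percolation.UniquenessInfiniteCluster
import Summits.CriticalPhenomena.PercolationContinuityZ3.Theses.PercNearOneGluing
import Summits.CriticalPhenomena.PercolationContinuityZ3.Theorems.PercNearOneGluingNearOneGluingWeightContinuity
import HarnessLib

/-!
# `HalfWeightReduction` (route PercNearOneGluing, item stmt-CriticalPhenomena-4579)

Kozma–Nitzan, arXiv:2401.12397, §5.6 (1), adapted to the asymptotic (`ε`–`δ`) statement:
Conjecture 3 for UNIFORM weight `1/2` on simple graphs (`bondPercolation G half`,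
`G : SimpleGraph (Fin N)`) implies `NearOneGluing` for arbitrary weights `w : Sym2 (Fin n) → [0,1]`.

Proof. Fix `ε > 0` and take the `δ` of the `1/2`-version at `ε / 2`; the same `δ` works.
Given `w, A, o, b` satisfying the (strict) hypotheses, replace every non-diagonal pair `e` by
`m e` internally disjoint chains of `ℓ + 2` half-edges (the gadget graph
`HalfGadget.graph M ℓ m` of `Literature/Probability/Percolation/SeriesParallelReduction.lean`),
with `m e` chosen so that the gadget reliability `HalfGadget.weight M ℓ m e` is within
`(1/2)^(ℓ+2)` of `w e` (`HalfGadget.exists_one_sub_pow_mem_Icc`). By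
`HalfGadget.real_openConn_inl` / `HalfGadget.real_biUnion_openConn_inl`
(`SeriesParallelReductionLaw.lean`) the connection probabilities among original vertices in the
`1/2`-model on the gadget graph are those of `prodBernoulli (weight M ℓ m)`; transported to
`Fin N` along `Fintype.equivFin` (`bondPercolation_real_preimage_relabel_iso`) the gadget graph is
an admissible `G`. As `ℓ → ∞` the weights tend to `w` off the diagonal (diagonal weights are
irrelevant to `openConn`), so by continuity in the weights (`stub_weightContinuity`) the
hypotheses of the `1/2`-version hold for all large `ℓ`, its conclusion `P > 1 − ε/2` passes to the
limit as `P_w(o ↔ b) ≥ 1 − ε/2 > 1 − ε`.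
-/

namespace Summit.CriticalPhenomena.PercolationContinuityZ3.Theorems

open MeasureTheory Filter Topology
open Literature.Probability.Percolation Literature.Probability.LatticeModels
open Literature.Probability.Percolation.HalfGadget
open Summit.CriticalPhenomena.PercolationContinuityZ3.Theses.PercNearOneGluing

/-! ### Diagonal weights are irrelevant to connection events -/

/-- Configurations with the same non-diagonal pairs have the same open graph. -/
theorem openGraph_eq_of_inter_eq {V : Type*} {ω ω' : Set (Sym2 V)}
    (h : ω ∩ {e | ¬ e.IsDiag} = ω' ∩ {e | ¬ e.IsDiag}) : openGraph ω = openGraph ω' := by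
  ext x y
  simp only [openGraph_adj]
  constructor
  · rintro ⟨hxy, hne⟩
    exact ⟨(mem_iff_mem_of_inter_eq h (by simpa using hne)).1 hxy, hne⟩
  · rintro ⟨hxy, hne⟩
    exact ⟨(mem_iff_mem_of_inter_eq h (by simpa using hne)).2 hxy, hne⟩

/-- `{u ↔ v}` is determined by the non-diagonal pairs. -/
theorem determinedBy_openConn_offDiag {V : Type*} (u v : V) :
    DeterminedBy (openConn u v) {e : Sym2 V | ¬ e.IsDiag} := by
  rw [determinedBy_iff]
  intro ω ω' h
  show (openGraph ω).Reachable u v ↔ (openGraph ω').Reachable u v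
  rw [openGraph_eq_of_inter_eq h]

/-- `{o ↔ A}` is determined by the non-diagonal pairs. -/
theorem determinedBy_biUnion_openConn_offDiag {V : Type*} (A : Finset V) (o : V) :
    DeterminedBy (⋃ a ∈ A, openConn o a) {e : Sym2 V | ¬ e.IsDiag} := by
  rw [determinedBy_iff]
  intro ω ω' h
  simp only [Set.mem_iUnion, exists_prop]
  refine exists_congr fun a => and_congr_right fun _ => ?_
  show (openGraph ω).Reachable o a ↔ (openGraph ω').Reachable o a
  rw [openGraph_eq_of_inter_eq h]

/-! ### Transport of `P_{1/2}` connection probabilities along a relabelling of the vertices -/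

/-- `P^{φ(G)}_p(φ x ↔ φ y) = P^G_p(x ↔ y)` for a bijection `φ` of the vertices. -/
theorem bondPercolation_real_openConn_map_equiv {V W : Type*} (G : SimpleGraph V) (φ : V ≃ W)
    (p : unitInterval) (x y : V) :
    (bondPercolation (G.map φ) p).real (openConn (φ x) (φ y)) =
      (bondPercolation G p).real (openConn x y) := by
  rw [← bondPercolation_real_preimage_relabel_iso (SimpleGraph.Iso.map φ G) p (openConn (φ x) (φ y))]
  congr 1
  ext ω
  exact reachable_relabel_iff φ ω x y

/-- `P^{φ(G)}_p(φ o ↔ φ(A)) = P^G_p(o ↔ A)` for a bijection `φ` of the vertices. -/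
theorem bondPercolation_real_biUnion_openConn_map_equiv {V W : Type*} [DecidableEq W]
    (G : SimpleGraph V) (φ : V ≃ W) (p : unitInterval) (A : Finset V) (o : V) :
    (bondPercolation (G.map φ) p).real (⋃ a ∈ A.image φ, openConn (φ o) a) =
      (bondPercolation G p).real (⋃ a ∈ A, openConn o a) := by
  rw [Finset.set_biUnion_finset_image,
    ← bondPercolation_real_preimage_relabel_iso (SimpleGraph.Iso.map φ G) p]
  congr 1
  ext ω
  simp only [Set.preimage_iUnion, Set.mem_iUnion, Set.mem_preimage, exists_prop]
  exact exists_congr fun a => and_congr_right fun _ => reachable_relabel_iff φ ω o a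

/-! ### The reduction -/

/-- **Kozma–Nitzan §5.6 (1): Conjecture 3 at uniform weight `1/2` on simple graphs implies
`NearOneGluing` for arbitrary weights** (item stmt-CriticalPhenomena-4579). -/
theorem halfWeightReduction_proof : HalfWeightReduction := by
  unfold HalfWeightReduction
  intro hH ε hε
  obtain ⟨δ, hδ, hHδ⟩ := hH (ε / 2) (half_pos hε)
  refine ⟨δ, hδ, ?_⟩
  intro n w A o b hoA hAb
  -- Step 0: kill the diagonal weights.
  set w' : Sym2 (Fin n) → unitInterval := fun e => if e.IsDiag then 0 else w e with hw'
  have hww' : ∀ e ∈ {e : Sym2 (Fin n) | ¬ e.IsDiag}, w e = w' e :=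
    fun e (he : ¬ e.IsDiag) => (if_neg he).symm
  have hoA' : (prodBernoulli w).real (⋃ a ∈ A, openConn o a) =
      (prodBernoulli w').real (⋃ a ∈ A, openConn o a) :=
    prodBernoulli_real_eq_of_determinedBy w w' hww' (determinedBy_biUnion_openConn_offDiag A o)
      MeasurableSet.of_discrete
  have hconn' : ∀ u v : Fin n, (prodBernoulli w).real (openConn u v) =
      (prodBernoulli w').real (openConn u v) := fun u v =>
    prodBernoulli_real_eq_of_determinedBy w w' hww' (determinedBy_openConn_offDiag u v)
      MeasurableSet.of_discrete
  -- Step 1: multiplicities `m ℓ e` with reliability within `(1/2)^(ℓ+2)` of `w e`.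
  have hq : ∀ ℓ : ℕ, (0 : ℝ) < (1 / 2) ^ (ℓ + 2) ∧ ((1 / 2 : ℝ) ^ (ℓ + 2) ≤ 1) := fun ℓ =>
    ⟨by positivity, pow_le_one₀ (by norm_num) (by norm_num)⟩
  choose m hm using fun (ℓ : ℕ) (e : Sym2 (Fin n)) =>
    exists_one_sub_pow_mem_Icc (hq ℓ).1 (hq ℓ).2 (w e).2.1 (w e).2.2
  set M : ℕ → ℕ := fun ℓ => Finset.univ.sup (m ℓ) with hM
  have hmM : ∀ ℓ e, min (M ℓ) (m ℓ e) = m ℓ e := fun ℓ e =>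
    min_eq_right (Finset.le_sup (f := m ℓ) (Finset.mem_univ e))
  -- the approximating weights
  set W : ℕ → Sym2 (Fin n) → unitInterval := fun ℓ => weight (M ℓ) ℓ (m ℓ) with hW
  have hWtend : Tendsto W atTop (𝓝 w') := by
    rw [tendsto_pi_nhds]
    intro e
    by_cases he : e.IsDiag
    · have h1 : (fun ℓ => W ℓ e) = fun _ => 0 := funext fun ℓ => weight_of_isDiag he
      have h2 : w' e = 0 := by simp only [hw', he, if_true]
      rw [h1, h2]
      exact tendsto_const_nhds
    · have h2 : w' e = w e := by simp only [hw', he, if_false]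
      rw [h2, tendsto_subtype_rng]
      have hcoe : ∀ ℓ, ((W ℓ e : unitInterval) : ℝ) = 1 - (1 - (1 / 2 : ℝ) ^ (ℓ + 2)) ^ (m ℓ e) := by
        intro ℓ
        rw [hW, coe_weight_of_not_isDiag he, hmM]
      have hpow : Tendsto (fun ℓ : ℕ => (1 / 2 : ℝ) ^ (ℓ + 2)) atTop (𝓝 0) :=
        (tendsto_pow_atTop_nhds_zero_of_lt_one (by norm_num) (by norm_num)).comp
          (tendsto_add_atTop_nat 2)
      have hlow : Tendsto (fun ℓ : ℕ => (w e : ℝ) - (1 / 2 : ℝ) ^ (ℓ + 2)) atTop (𝓝 (w e : ℝ)) := by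
        simpa using (tendsto_const_nhds (x := (w e : ℝ))).sub hpow
      refine tendsto_of_tendsto_of_tendsto_of_le_of_le hlow tendsto_const_nhds
        (fun ℓ => ?_) (fun ℓ => ?_)
      · rw [hcoe]; exact (hm ℓ e).1
      · rw [hcoe]; exact (hm ℓ e).2
  -- Step 2: continuity in the weights along `W ℓ → w'`.
  have hlim : ∀ E : Set (BondConfig (Fin n)),
      Tendsto (fun ℓ => (prodBernoulli (W ℓ)).real E) atTop (𝓝 ((prodBernoulli w').real E)) :=
    fun E => ((stub_weightContinuity n E).tendsto w').comp hWtend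
  -- Step 3: the `1/2`-version on the gadget graphs, transported to `Fin N`.
  have hstep : ∀ ℓ : ℕ, 1 - δ < (prodBernoulli (W ℓ)).real (⋃ a ∈ A, openConn o a) →
      (∀ a ∈ A, 1 - δ < (prodBernoulli (W ℓ)).real (openConn a b)) →
        1 - ε / 2 < (prodBernoulli (W ℓ)).real (openConn o b) := by
    intro ℓ h1 h2
    set Γ := graph (V := Fin n) (M ℓ) ℓ (m ℓ) with hΓ
    set φ := Fintype.equivFin (Vertex (Fin n) (M ℓ) ℓ) with hφ
    have key := hHδ _ (Γ.map φ) (A.image fun a => φ (Sum.inl a)) (φ (Sum.inl o)) (φ (Sum.inl b))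
    rw [bondPercolation_real_openConn_map_equiv, real_openConn_inl] at key
    refine key ?_ ?_
    · have himage : A.image (fun a => φ (Sum.inl a)) = (A.image Sum.inl).image φ := by
        rw [Finset.image_image]; rfl
      rw [himage, bondPercolation_real_biUnion_openConn_map_equiv, Finset.set_biUnion_finset_image,
        real_biUnion_openConn_inl]
      exact h1
    · intro a' ha'
      obtain ⟨a, ha, rfl⟩ := Finset.mem_image.1 ha'
      rw [bondPercolation_real_openConn_map_equiv, real_openConn_inl]
      exact h2 a ha
  -- Step 4: the hypotheses hold for all large `ℓ`; pass to the limit in the conclusion.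
  have hev1 : ∀ᶠ ℓ in atTop, 1 - δ < (prodBernoulli (W ℓ)).real (⋃ a ∈ A, openConn o a) :=
    (hlim _).eventually_const_lt (by rw [← hoA']; exact hoA)
  have hev2 : ∀ᶠ ℓ in atTop, ∀ a ∈ A, 1 - δ < (prodBernoulli (W ℓ)).real (openConn a b) :=
    (Finset.eventually_all A).2 fun a ha =>
      (hlim _).eventually_const_lt (by rw [← hconn']; exact hAb a ha)
  have hev : ∀ᶠ ℓ in atTop, 1 - ε / 2 ≤ (prodBernoulli (W ℓ)).real (openConn o b) := by
    filter_upwards [hev1, hev2] with ℓ h1 h2 using (hstep ℓ h1 h2).le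
  have hle : 1 - ε / 2 ≤ (prodBernoulli w').real (openConn o b) := ge_of_tendsto (hlim _) hev
  rw [hconn']
  linarith

end Summit.CriticalPhenomena.PercolationContinuityZ3.Theorems
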